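import Mathlib
import Literature.Analysis.FluidPDE.VectorCalculus

/-!
# Backus bound in Hubble flow — vector calculus on `ℝ³` (route HubbleDynamo, item `BackusRung`)

Support lemmas for the proof of `BackusRung` (item stmt-NavierStokesRegularity-1939): the
Laplacian and the divergence in coordinates, the pointwise expansion
`curl((U + a y) × b) = −2a b + (b·∇)U − (U·∇)b − a (y·∇)b` for divergence-free `U`, `b`
(Majda–Bertozzi, *Vorticity and Incompressible Flow*, §1.1, vector identities, in the in-tree
`curl`/`cross` conventions of `Literature.Analysis.FluidPDE.VectorCalculus`), a family of smooth
cutoffs, the whole-space divergence lemma `∫ ∑ⱼ ∂ⱼ Gⱼ = 0` for `Gⱼ, ∑ⱼ ∂ⱼ Gⱼ ∈ L¹` (cutoff +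
dominated convergence), an integration-by-parts formula for `∫ c ⟪f, ∂_v g⟫` (Mathlib's
`integral_bilinear_hasFDerivAt_right_eq_neg_left_of_integrable`), and the pointwise
Cauchy–Schwarz/Young step `|∑ⱼ bⱼ ⟪∂ⱼ b, U⟫| ≤ ν ∑ⱼ ‖∂ⱼ b‖² + (C₀²/4ν) ‖b‖²`.
Coordinates are taken along `EuclideanSpace.single j 1`, the basis used by the in-tree `curl`.
-/

noncomputable section

open MeasureTheory Filter Topology WithLp
open scoped RealInnerProductSpace

-- tree namespace `Summit.<S>.<S>.Theorems` (summit = sub-problem), as in every Theorems file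
set_option linter.dupNamespace false

namespace Summit.NavierStokesRegularity.NavierStokesRegularity.Theorems

open Literature.Analysis.FluidPDE

/-! ### Coordinates on `ℝ³` -/

/-- The standard basis vectors have norm one. -/
theorem backus_norm_single (j : Fin 3) :
    ‖(EuclideanSpace.single j (1 : ℝ) : EuclideanSpace ℝ (Fin 3))‖ = 1 := by
  simp

/-- `‖L eⱼ‖ ≤ ‖L‖` for the operator norm. -/
theorem backus_norm_apply_single_le {F : Type*} [NormedAddCommGroup F] [NormedSpace ℝ F]
    (L : EuclideanSpace ℝ (Fin 3) →L[ℝ] F) (j : Fin 3) : ‖L (EuclideanSpace.single j 1)‖ ≤ ‖L‖ := by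
  have h := L.le_opNorm (EuclideanSpace.single j 1)
  rwa [backus_norm_single, mul_one] at h

/-- The squared norm is the sum of the squared coordinates. -/
theorem backus_norm_sq_eq_sum (v : EuclideanSpace ℝ (Fin 3)) : ‖v‖ ^ 2 = ∑ j, v j ^ 2 :=
  EuclideanSpace.real_norm_sq_eq v

/-! ### Second derivatives and the Laplacian in coordinates -/

/-- For a `C²` map, the partial derivative `y ↦ Db(y) v` is differentiable with derivative
`w ↦ D²b(x) w v`. -/
theorem backus_hasFDerivAt_partial {F : Type*} [NormedAddCommGroup F] [NormedSpace ℝ F]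
    {b : EuclideanSpace ℝ (Fin 3) → F} (hb : ContDiff ℝ 2 b) (x v : EuclideanSpace ℝ (Fin 3)) :
    HasFDerivAt (fun y => fderiv ℝ b y v)
      ((ContinuousLinearMap.apply ℝ F v).comp (fderiv ℝ (fderiv ℝ b) x)) x := by
  have h1 : ContDiff ℝ 1 (fderiv ℝ b) := hb.fderiv_right (m := 1) (by norm_num)
  have hD : HasFDerivAt (fderiv ℝ b) (fderiv ℝ (fderiv ℝ b) x) x :=
    (h1.differentiable one_ne_zero x).hasFDerivAt
  exact (ContinuousLinearMap.apply ℝ F v).hasFDerivAt.comp x hD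

/-- For a `C²` map, `∂_w (y ↦ Db(y) v) (x) = D²b(x) w v`. -/
theorem backus_fderiv_partial {F : Type*} [NormedAddCommGroup F] [NormedSpace ℝ F]
    {b : EuclideanSpace ℝ (Fin 3) → F} (hb : ContDiff ℝ 2 b) (x v w : EuclideanSpace ℝ (Fin 3)) :
    fderiv ℝ (fun y => fderiv ℝ b y v) x w = fderiv ℝ (fderiv ℝ b) x w v := by
  rw [(backus_hasFDerivAt_partial hb x v).fderiv]
  simp

/-- The Laplacian on `ℝ³` in coordinates: `Δ b (x) = ∑ⱼ D²b(x) eⱼ eⱼ`. -/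
theorem backus_laplacian_eq_sum {F : Type*} [NormedAddCommGroup F] [NormedSpace ℝ F]
    (b : EuclideanSpace ℝ (Fin 3) → F) (x : EuclideanSpace ℝ (Fin 3)) :
    Laplacian.laplacian b x = ∑ j, fderiv ℝ (fderiv ℝ b) x (EuclideanSpace.single j 1)
        (EuclideanSpace.single j 1) := by
  rw [InnerProductSpace.laplacian_eq_iteratedFDeriv_orthonormalBasis b
    (EuclideanSpace.basisFun (Fin 3) ℝ)]
  simp [iteratedFDeriv_two_apply]

/-- Derivative of `Gⱼ = ⟪b, ∂ⱼ b⟫` in direction `eⱼ`: `∂ⱼ Gⱼ = ‖∂ⱼ b‖² + ⟪b, D²b eⱼ eⱼ⟫`. -/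
theorem backus_fderiv_inner_partial {b : EuclideanSpace ℝ (Fin 3) → EuclideanSpace ℝ (Fin 3)} (hb
    : ContDiff ℝ 2 b) (x : EuclideanSpace ℝ (Fin 3)) (j : Fin 3) :
    fderiv ℝ (fun y => ⟪b y, fderiv ℝ b y (EuclideanSpace.single j 1)⟫) x (EuclideanSpace.single j
        1) =
      ‖fderiv ℝ b x (EuclideanSpace.single j 1)‖ ^ 2 + ⟪b x, fderiv ℝ (fderiv ℝ b) x
          (EuclideanSpace.single j 1) (EuclideanSpace.single j 1)⟫ := by
  have hbd : DifferentiableAt ℝ b x := (hb.differentiable two_ne_zero x)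
  have hpd : DifferentiableAt ℝ (fun y => fderiv ℝ b y (EuclideanSpace.single j 1)) x :=
    (backus_hasFDerivAt_partial hb x (EuclideanSpace.single j 1)).differentiableAt
  rw [fderiv_inner_apply ℝ hbd hpd, backus_fderiv_partial hb, real_inner_self_eq_norm_sq]
  ring

/-- `⟪b, Δb⟫ = ∑ⱼ ∂ⱼ⟪b, ∂ⱼ b⟫ − ∑ⱼ ‖∂ⱼ b‖²` pointwise, for a `C²` field on `ℝ³`. -/
theorem backus_inner_laplacian {b : EuclideanSpace ℝ (Fin 3) → EuclideanSpace ℝ (Fin 3)} (hb :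
    ContDiff ℝ 2 b) (x : EuclideanSpace ℝ (Fin 3)) :
    ⟪b x, Laplacian.laplacian b x⟫ =
      ∑ j, fderiv ℝ (fun y => ⟪b y, fderiv ℝ b y (EuclideanSpace.single j 1)⟫) x
          (EuclideanSpace.single j 1) -
        ∑ j, ‖fderiv ℝ b x (EuclideanSpace.single j 1)‖ ^ 2 := by
  simp_rw [backus_fderiv_inner_partial hb, Finset.sum_add_distrib, backus_laplacian_eq_sum,
    inner_sum]
  ring

/-! ### The curl of `V × b` in the Hubble flow -/

/-- The divergence in coordinates: `div v (x) = ∑ⱼ (Dv(x) eⱼ)ⱼ`. -/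
theorem backus_divergence_eq_sum (v : EuclideanSpace ℝ (Fin 3) → EuclideanSpace ℝ (Fin 3)) (x :
    EuclideanSpace ℝ (Fin 3)) :
    VectorCalculus.divergence v x = ∑ j, fderiv ℝ v x (EuclideanSpace.single j 1) j := by
  rw [divergence_eq_sum_inner_fderiv (EuclideanSpace.basisFun (Fin 3) ℝ)]
  simp [EuclideanSpace.inner_single_left]

/-- Pointwise expansion of `curl((U + a y) × b)` for divergence-free `U`, `b`:
`curl(V × b) = −2a b + (b·∇)U − (U·∇)b − a (y·∇)b`. -/
theorem backus_curl_cross_expand {U b : EuclideanSpace ℝ (Fin 3) → EuclideanSpace ℝ (Fin 3)} {a :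
    ℝ} {x : EuclideanSpace ℝ (Fin 3)}
    (hU : DifferentiableAt ℝ U x) (hb : DifferentiableAt ℝ b x)
    (hdivU : ∑ j, fderiv ℝ U x (EuclideanSpace.single j 1) j = 0) (hdivb : ∑ j, fderiv ℝ b x
        (EuclideanSpace.single j 1) j = 0) :
    curl (fun z => cross (U z + a • z) (b z)) x =
      -(2 * a) • b x + ∑ j, b x j • fderiv ℝ U x (EuclideanSpace.single j 1) - ∑ j, U x j • fderiv
          ℝ b x (EuclideanSpace.single j 1)
        - a • ∑ j, x j • fderiv ℝ b x (EuclideanSpace.single j 1) := by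
  have hV : HasFDerivAt (fun z => U z + a • z)
      (fderiv ℝ U x + a • ContinuousLinearMap.id ℝ (EuclideanSpace ℝ (Fin 3))) x :=
    hU.hasFDerivAt.add ((hasFDerivAt_id x).const_smul a)
  have hX := hasFDerivAt_cross hV hb.hasFDerivAt
  simp only [Fin.sum_univ_three] at hdivU hdivb ⊢
  simp only [curl]
  rw [hX.fderiv]
  ext k
  fin_cases k
  · simp [cross, cross_apply, crossCLM_apply, ContinuousLinearMap.precompR_apply,
      ContinuousLinearMap.precompL_apply, Matrix.cons_val_zero,
      Matrix.cons_val_one, Matrix.cons_val_two, Matrix.head_cons, Matrix.tail_cons]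
    linear_combination (U x 0 + a * x 0) * hdivb - (b x 0) * hdivU
  · simp [cross, cross_apply, crossCLM_apply, ContinuousLinearMap.precompR_apply,
      ContinuousLinearMap.precompL_apply, Matrix.cons_val_zero,
      Matrix.cons_val_one, Matrix.cons_val_two, Matrix.head_cons, Matrix.tail_cons]
    linear_combination (U x 1 + a * x 1) * hdivb - (b x 1) * hdivU
  · simp [cross, cross_apply, crossCLM_apply, ContinuousLinearMap.precompR_apply,
      ContinuousLinearMap.precompL_apply, Matrix.cons_val_zero,
      Matrix.cons_val_one, Matrix.cons_val_two, Matrix.head_cons, Matrix.tail_cons]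
    linear_combination (U x 2 + a * x 2) * hdivb - (b x 2) * hdivU

/-! ### A family of smooth cutoffs and the whole-space divergence lemma -/

/-- A family of `C¹` cutoffs `χ_R` on `ℝ³`: `|χ_R| ≤ 1`, `χ_R = 1` on the ball of radius `R`,
compactly supported, with `|∂_v χ_R| ≤ M ‖v‖ / R`. -/
theorem backus_cutoff_family : ∃ (χ : ℝ → EuclideanSpace ℝ (Fin 3) → ℝ) (M : ℝ),
    (∀ R, ContDiff ℝ 1 (χ R)) ∧
    (∀ R y, |χ R y| ≤ 1) ∧
    (∀ R y, 0 < R → ‖y‖ ≤ R → χ R y = 1) ∧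
    (∀ R, 0 < R → HasCompactSupport (χ R)) ∧
    (∀ R y v, 0 < R → |fderiv ℝ (χ R) y v| ≤ R⁻¹ * M * ‖v‖) := by
  let φ : ContDiffBump (0 : EuclideanSpace ℝ (Fin 3)) := ⟨1, 2, one_pos, one_lt_two⟩
  have hφd : ContDiff ℝ 1 φ := φ.contDiff
  have hφdiff : Differentiable ℝ φ := hφd.differentiable one_ne_zero
  obtain ⟨M, hM⟩ : ∃ M, ∀ y, ‖fderiv ℝ φ y‖ ≤ M :=
    (hφd.continuous_fderiv one_ne_zero).bounded_above_of_compact_support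
      (φ.hasCompactSupport.fderiv (𝕜 := ℝ))
  refine ⟨fun R y => φ (R⁻¹ • y), M, ?_, ?_, ?_, ?_, ?_⟩
  · intro R
    exact hφd.comp (contDiff_const_smul R⁻¹)
  · intro R y
    rw [abs_of_nonneg φ.nonneg]
    exact φ.le_one
  · intro R y hR hy
    apply φ.one_of_mem_closedBall
    rw [Metric.mem_closedBall, dist_zero_right, norm_smul, norm_inv, Real.norm_of_nonneg hR.le]
    show R⁻¹ * ‖y‖ ≤ 1
    rw [inv_mul_le_iff₀ hR, mul_one]
    exact hy
  · intro R hR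
    apply HasCompactSupport.intro (isCompact_closedBall (0 : EuclideanSpace ℝ (Fin 3)) (2 * R))
    intro y hy
    apply φ.zero_of_le_dist
    rw [Metric.mem_closedBall, dist_zero_right, not_le] at hy
    rw [dist_zero_right, norm_smul, norm_inv, Real.norm_of_nonneg hR.le]
    show (2 : ℝ) ≤ R⁻¹ * ‖y‖
    rw [le_inv_mul_iff₀ hR]
    linarith
  · intro R y v hR
    have h : HasFDerivAt (fun y => φ (R⁻¹ • y))
        ((fderiv ℝ φ (R⁻¹ • y)).comp (R⁻¹ • ContinuousLinearMap.id ℝ (EuclideanSpace ℝ (Fin 3))))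
            y :=
      (hφdiff (R⁻¹ • y)).hasFDerivAt.comp y ((hasFDerivAt_id y).const_smul R⁻¹)
    have happ : ((fderiv ℝ φ (R⁻¹ • y)).comp (R⁻¹ • ContinuousLinearMap.id ℝ (EuclideanSpace ℝ
        (Fin 3)))) v =
        R⁻¹ * fderiv ℝ φ (R⁻¹ • y) v := by
      simp
    rw [h.fderiv, happ, abs_mul, abs_of_pos (inv_pos.2 hR), mul_assoc]
    refine mul_le_mul_of_nonneg_left ?_ (inv_pos.2 hR).le
    calc |fderiv ℝ φ (R⁻¹ • y) v| = ‖fderiv ℝ φ (R⁻¹ • y) v‖ := (Real.norm_eq_abs _).symm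
      _ ≤ ‖fderiv ℝ φ (R⁻¹ • y)‖ * ‖v‖ := ContinuousLinearMap.le_opNorm _ _
      _ ≤ M * ‖v‖ := mul_le_mul_of_nonneg_right (hM _) (norm_nonneg _)

/-- Whole-space divergence lemma on `ℝ³`: if the `C¹` scalar fields `Gⱼ` are integrable and
`∑ⱼ ∂ⱼ Gⱼ` is integrable, then `∫ ∑ⱼ ∂ⱼ Gⱼ = 0` (cutoff argument: `∫ χ_R ∑ⱼ ∂ⱼGⱼ = −∑ⱼ ∫ ∂ⱼχ_R Gⱼ
= O(1/R)`, and `∫ χ_R ∑ⱼ ∂ⱼGⱼ → ∫ ∑ⱼ ∂ⱼGⱼ` by dominated convergence). -/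
theorem backus_integral_sum_partial_eq_zero (G : Fin 3 → EuclideanSpace ℝ (Fin 3) → ℝ)
    (hG : ∀ j, ContDiff ℝ 1 (G j)) (hGi : ∀ j, Integrable (G j))
    (hdiv : Integrable fun y => ∑ j, fderiv ℝ (G j) y (EuclideanSpace.single j 1)) :
    ∫ y, ∑ j, fderiv ℝ (G j) y (EuclideanSpace.single j 1) = 0 := by
  obtain ⟨χ, M, hχd, hχ1, hχone, hχsupp, hχM⟩ := backus_cutoff_family
  have hGc : ∀ j, Continuous (G j) := fun j => (hG j).continuous
  have hdGc : ∀ j, Continuous fun y => fderiv ℝ (G j) y (EuclideanSpace.single j 1) :=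
    fun j => ((hG j).continuous_fderiv one_ne_zero).clm_apply continuous_const
  have hχc : ∀ R, Continuous (χ R) := fun R => (hχd R).continuous
  have hdχc : ∀ R j, Continuous fun y => fderiv ℝ (χ R) y (EuclideanSpace.single j 1) :=
    fun R j => ((hχd R).continuous_fderiv one_ne_zero).clm_apply continuous_const
  have hI1 : ∀ R, 0 < R → ∀ j, Integrable (fun y => fderiv ℝ (χ R) y (EuclideanSpace.single j 1) *
      G j y) :=
    fun R hR j => (hGi j).bdd_mul (hdχc R j).aestronglyMeasurable
      (ae_of_all _ fun y => by
        rw [Real.norm_eq_abs]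
        exact hχM R y (EuclideanSpace.single j 1) hR)
  -- Step 1: integrate by parts against the cutoff, one direction at a time
  have hstep : ∀ R, 0 < R → ∫ y, χ R y * ∑ j, fderiv ℝ (G j) y (EuclideanSpace.single j 1) =
      -∑ j, ∫ y, fderiv ℝ (χ R) y (EuclideanSpace.single j 1) * G j y := by
    intro R hR
    have hI2 : ∀ j, Integrable (fun y => χ R y * fderiv ℝ (G j) y (EuclideanSpace.single j 1)) :=
        fun j =>
      ((hχc R).mul (hdGc j)).integrable_of_hasCompactSupport (hχsupp R hR).mul_right
    have hI3 : ∀ j, Integrable (fun y => χ R y * G j y) := fun j =>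
      ((hχc R).mul (hGc j)).integrable_of_hasCompactSupport (hχsupp R hR).mul_right
    calc ∫ y, χ R y * ∑ j, fderiv ℝ (G j) y (EuclideanSpace.single j 1)
        = ∫ y, ∑ j, χ R y * fderiv ℝ (G j) y (EuclideanSpace.single j 1) := by simp_rw
            [Finset.mul_sum]
      _ = ∑ j, ∫ y, χ R y * fderiv ℝ (G j) y (EuclideanSpace.single j 1) := integral_finsetSum _
          fun j _ => hI2 j
      _ = ∑ j, -∫ y, fderiv ℝ (χ R) y (EuclideanSpace.single j 1) * G j y := by
          refine Finset.sum_congr rfl fun j _ => ?_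
          exact integral_mul_fderiv_eq_neg_fderiv_mul_of_integrable (hI1 R hR j) (hI2 j) (hI3 j)
            (fun y _ => (hχd R).differentiable one_ne_zero y)
            (fun y _ => (hG j).differentiable one_ne_zero y)
      _ = -∑ j, ∫ y, fderiv ℝ (χ R) y (EuclideanSpace.single j 1) * G j y := by rw
          [Finset.sum_neg_distrib]
  -- Step 2: the boundary-type term is `O(1/R)`
  have hsmall : ∀ R, 0 < R →
      |∑ j, ∫ y, fderiv ℝ (χ R) y (EuclideanSpace.single j 1) * G j y| ≤ R⁻¹ * (M * ∑ j, ∫ y, |G j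
          y|) := by
    intro R hR
    calc |∑ j, ∫ y, fderiv ℝ (χ R) y (EuclideanSpace.single j 1) * G j y|
        ≤ ∑ j, |∫ y, fderiv ℝ (χ R) y (EuclideanSpace.single j 1) * G j y| :=
            Finset.abs_sum_le_sum_abs _ _
      _ ≤ ∑ j, ∫ y, R⁻¹ * M * |G j y| := by
          refine Finset.sum_le_sum fun j _ => ?_
          refine abs_integral_le_integral_abs.trans ?_
          refine integral_mono (hI1 R hR j).abs ((hGi j).abs.const_mul _) fun y => ?_
          dsimp only
          rw [abs_mul]
          refine mul_le_mul_of_nonneg_right ?_ (abs_nonneg _)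
          simpa [backus_norm_single] using hχM R y (EuclideanSpace.single j 1) hR
      _ = R⁻¹ * (M * ∑ j, ∫ y, |G j y|) := by
          rw [Finset.mul_sum, Finset.mul_sum]
          refine Finset.sum_congr rfl fun j _ => ?_
          rw [integral_const_mul]
          ring
  -- Step 3: the cut-off integrals converge to the full integral (dominated convergence)
  have hlim : Tendsto (fun R => ∫ y, χ R y * ∑ j, fderiv ℝ (G j) y (EuclideanSpace.single j 1))
      atTop
      (𝓝 (∫ y, ∑ j, fderiv ℝ (G j) y (EuclideanSpace.single j 1))) := by
    refine tendsto_integral_filter_of_dominated_convergence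
      (fun y => ‖∑ j, fderiv ℝ (G j) y (EuclideanSpace.single j 1)‖) ?_ ?_ hdiv.norm ?_
    · exact Eventually.of_forall fun R =>
        ((hχc R).mul (continuous_finsetSum _ fun j _ => hdGc j)).aestronglyMeasurable
    · refine Eventually.of_forall fun R => ae_of_all _ fun y => ?_
      rw [norm_mul]
      refine mul_le_of_le_one_left (norm_nonneg _) ?_
      rw [Real.norm_eq_abs]
      exact hχ1 R y
    · refine ae_of_all _ fun y => ?_
      apply tendsto_const_nhds.congr'
      filter_upwards [eventually_ge_atTop ‖y‖, eventually_gt_atTop (0 : ℝ)] with R hR hR0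
      rw [hχone R y hR0 hR, one_mul]
  -- Step 4: ... and to zero
  have hlim0 : Tendsto (fun R => ∫ y, χ R y * ∑ j, fderiv ℝ (G j) y (EuclideanSpace.single j 1))
      atTop (𝓝 0) := by
    have hK : Tendsto (fun R : ℝ => R⁻¹ * (M * ∑ j, ∫ y, |G j y|)) atTop (𝓝 0) := by
      simpa using tendsto_inv_atTop_zero.mul_const (M * ∑ j, ∫ y, |G j y|)
    rw [tendsto_zero_iff_norm_tendsto_zero]
    refine squeeze_zero' (Eventually.of_forall fun R => norm_nonneg _) ?_ hK
    filter_upwards [eventually_gt_atTop (0 : ℝ)] with R hR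
    rw [Real.norm_eq_abs, hstep R hR, abs_neg]
    exact hsmall R hR
  exact tendsto_nhds_unique hlim hlim0

/-! ### Integration by parts against a scalar weight -/

/-- Whole-space integration by parts on `ℝ³` in direction `v` for `∫ c ⟪f, ∂_v g⟫`, with a
scalar weight `c`: `∫ c ⟪f, ∂_v g⟫ = −∫ (∂_v c) ⟪f, g⟫ − ∫ c ⟪∂_v f, g⟫`, provided all four
products are integrable (Mathlib's `integral_bilinear_hasFDerivAt_right_eq_neg_left_of_integrable`
for the pairing `⟪·, ·⟫` and the field `c • f`). -/
theorem backus_ibp_smul_inner {c : EuclideanSpace ℝ (Fin 3) → ℝ} {f g : EuclideanSpace ℝ (Fin 3) →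
    EuclideanSpace ℝ (Fin 3)} (v : EuclideanSpace ℝ (Fin 3))
    (hc : Differentiable ℝ c) (hf : Differentiable ℝ f) (hg : Differentiable ℝ g)
    (h1 : Integrable fun y => c y * ⟪f y, fderiv ℝ g y v⟫)
    (h2 : Integrable fun y => fderiv ℝ c y v * ⟪f y, g y⟫)
    (h3 : Integrable fun y => c y * ⟪fderiv ℝ f y v, g y⟫)
    (h4 : Integrable fun y => c y * ⟪f y, g y⟫) :
    ∫ y, c y * ⟪f y, fderiv ℝ g y v⟫ =
      -(∫ y, fderiv ℝ c y v * ⟪f y, g y⟫) - ∫ y, c y * ⟪fderiv ℝ f y v, g y⟫ := by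
  have hF : ∀ y, HasFDerivAt (fun y => c y • f y)
      (c y • fderiv ℝ f y + (fderiv ℝ c y).smulRight (f y)) y :=
    fun y => (hc y).hasFDerivAt.fun_smul (hf y).hasFDerivAt
  have key := integral_bilinear_hasFDerivAt_right_eq_neg_left_of_integrable
    (μ := (volume : Measure (EuclideanSpace ℝ (Fin 3))))
    (f := fun y => c y • f y) (f' := fun y => c y • fderiv ℝ f y + (fderiv ℝ c y).smulRight (f y))
    (g := g) (g' := fderiv ℝ g) (v := v) (B := innerSL ℝ (E := EuclideanSpace ℝ (Fin 3))) ?_ ?_ ?_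
    (fun y _ => hF y) (fun y _ => (hg y).hasFDerivAt)
  · have key' : ∫ y, ⟪c y • f y, fderiv ℝ g y v⟫ =
        -∫ y, ⟪c y • fderiv ℝ f y v + fderiv ℝ c y v • f y, g y⟫ := key
    simp only [inner_add_left, real_inner_smul_left] at key'
    rw [key', integral_add h3 h2]
    ring
  · refine (h3.add h2).congr (ae_of_all _ fun y => ?_)
    change _ = ⟪c y • fderiv ℝ f y v + fderiv ℝ c y v • f y, g y⟫
    rw [Pi.add_apply, inner_add_left, real_inner_smul_left, real_inner_smul_left]
  · refine h1.congr (ae_of_all _ fun y => ?_)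
    change _ = ⟪c y • f y, fderiv ℝ g y v⟫
    rw [real_inner_smul_left]
  · refine h4.congr (ae_of_all _ fun y => ?_)
    change _ = ⟪c y • f y, g y⟫
    rw [real_inner_smul_left]

/-! ### Coordinate functions -/

/-- The coordinate function `z ↦ zⱼ` has derivative `v ↦ vⱼ`. -/
theorem backus_fderiv_coord (j : Fin 3) (y v : EuclideanSpace ℝ (Fin 3)) :
    fderiv ℝ (fun z : EuclideanSpace ℝ (Fin 3) => z j) y v = v j := by
  have h : HasFDerivAt (fun z : EuclideanSpace ℝ (Fin 3) => z j) (EuclideanSpace.proj j :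
      EuclideanSpace ℝ (Fin 3) →L[ℝ] ℝ) y :=
    (EuclideanSpace.proj (𝕜 := ℝ) j).hasFDerivAt
  rw [h.fderiv]
  rfl

/-- The coordinate function `z ↦ zⱼ` is differentiable. -/
theorem backus_differentiable_coord (j : Fin 3) : Differentiable ℝ (fun z : EuclideanSpace ℝ (Fin
    3) => z j) :=
  (EuclideanSpace.proj (𝕜 := ℝ) j).differentiable

/-- Coordinates of a differentiable field: `∂_v (fⱼ) = (∂_v f)ⱼ`. -/
theorem backus_fderiv_apply_coord {f : EuclideanSpace ℝ (Fin 3) → EuclideanSpace ℝ (Fin 3)} (hf :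
    Differentiable ℝ f) (j : Fin 3)
    (y v : EuclideanSpace ℝ (Fin 3)) : fderiv ℝ (fun z => f z j) y v = fderiv ℝ f y v j := by
  have h : HasFDerivAt (fun z => f z j) ((EuclideanSpace.proj j : EuclideanSpace ℝ (Fin 3) →L[ℝ]
      ℝ).comp (fderiv ℝ f y))
      y := (EuclideanSpace.proj (𝕜 := ℝ) j).hasFDerivAt.comp y (hf y).hasFDerivAt
  rw [h.fderiv]
  rfl

/-- Coordinates of a differentiable field are differentiable. -/
theorem backus_differentiable_apply_coord {f : EuclideanSpace ℝ (Fin 3) → EuclideanSpace ℝ (Fin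
    3)} (hf : Differentiable ℝ f) (j : Fin 3) :
    Differentiable ℝ (fun z => f z j) :=
  (EuclideanSpace.proj (𝕜 := ℝ) j).differentiable.comp hf

/-! ### The pointwise Young / Cauchy–Schwarz step -/

/-- Young's inequality in the form used by the Backus bound:
`C₀ T ≤ ν S + (C₀² / 4ν) P` whenever `T² ≤ P S`. -/
theorem backus_young {ν C₀ T P S : ℝ} (hν : 0 < ν) (hC : 0 ≤ C₀) (hT : 0 ≤ T) (hP : 0 ≤ P)
    (hS : 0 ≤ S) (hTsq : T ^ 2 ≤ P * S) : C₀ * T ≤ ν * S + C₀ ^ 2 / (4 * ν) * P := by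
  have h3 : 4 * ν * (ν * S + C₀ ^ 2 / (4 * ν) * P) = 4 * ν ^ 2 * S + C₀ ^ 2 * P := by
    field_simp
  have h2 : (4 * ν * (C₀ * T)) ^ 2 ≤ (4 * ν * (ν * S + C₀ ^ 2 / (4 * ν) * P)) ^ 2 := by
    rw [h3]
    nlinarith [mul_le_mul_of_nonneg_left hTsq (mul_nonneg (sq_nonneg ν) (sq_nonneg C₀)),
      sq_nonneg (4 * ν ^ 2 * S - C₀ ^ 2 * P)]
  have h4 : 4 * ν * (C₀ * T) ≤ 4 * ν * (ν * S + C₀ ^ 2 / (4 * ν) * P) :=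
    (sq_le_sq₀ (by positivity) (by positivity)).1 h2
  exact le_of_mul_le_mul_left h4 (by positivity)

/-- The pointwise stretching bound: `|∑ⱼ bⱼ ⟪∂ⱼ b, U⟫| ≤ ν ∑ⱼ ‖∂ⱼ b‖² + (C₀²/4ν) ‖b‖²` when
`‖U‖ ≤ C₀` (Cauchy–Schwarz in `j`, then Young). -/
theorem backus_stretching_bound {ν C₀ : ℝ} (hν : 0 < ν) (hC : 0 ≤ C₀) (bx Ux : EuclideanSpace ℝ
    (Fin 3))
    (D : Fin 3 → EuclideanSpace ℝ (Fin 3)) (hU : ‖Ux‖ ≤ C₀) :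
    |∑ j, bx j * ⟪D j, Ux⟫| ≤ ν * ∑ j, ‖D j‖ ^ 2 + C₀ ^ 2 / (4 * ν) * ‖bx‖ ^ 2 := by
  set T := ∑ j, |bx j| * ‖D j‖ with hT
  have hT0 : 0 ≤ T := Finset.sum_nonneg fun j _ => mul_nonneg (abs_nonneg _) (norm_nonneg _)
  have hTsq : T ^ 2 ≤ ‖bx‖ ^ 2 * ∑ j, ‖D j‖ ^ 2 := by
    calc T ^ 2 ≤ (∑ j, |bx j| ^ 2) * ∑ j, ‖D j‖ ^ 2 := Finset.sum_mul_sq_le_sq_mul_sq _ _ _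
      _ = ‖bx‖ ^ 2 * ∑ j, ‖D j‖ ^ 2 := by simp [backus_norm_sq_eq_sum, sq_abs]
  have hle : |∑ j, bx j * ⟪D j, Ux⟫| ≤ C₀ * T := by
    calc |∑ j, bx j * ⟪D j, Ux⟫| ≤ ∑ j, |bx j * ⟪D j, Ux⟫| := Finset.abs_sum_le_sum_abs _ _
      _ ≤ ∑ j, |bx j| * ‖D j‖ * C₀ := by
          refine Finset.sum_le_sum fun j _ => ?_
          rw [abs_mul, mul_assoc]
          refine mul_le_mul_of_nonneg_left ?_ (abs_nonneg _)
          exact (abs_real_inner_le_norm _ _).trans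
            (mul_le_mul_of_nonneg_left hU (norm_nonneg _))
      _ = C₀ * T := by rw [hT, Finset.mul_sum]; exact Finset.sum_congr rfl fun j _ => by ring
  exact hle.trans (backus_young hν hC hT0 (sq_nonneg _)
    (Finset.sum_nonneg fun j _ => sq_nonneg _) hTsq)

end Summit.NavierStokesRegularity.NavierStokesRegularity.Theorems
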